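import Literature.NumberTheory.Automorphic.BaseChangeInductionAlong
import Literature.NumberTheory.Automorphic.AutomorphicTwistNorm
import Literature.NumberTheory.Automorphic.PairLFunctionBaseChange
import HarnessLib

/-!
# Automorphic induction (Arthur–Clozel, Def. 6.1) is compatible with the twists `⊗ |det|_𝔸^s`

Topic `NumberTheory/Automorphic`; theorems only. If `P` on `GL_N(𝔸_K)` is (weakly)
automorphically induced from `π` on `GL_n(𝔸_L)` along `L/K` (`IsAutomorphicInductionAlong π P`,
the a.e. Hecke–Satake relation `∏_{a ∈ t_{P,v}} (X - a) = ∏_{w ∣ v} ∏_{b ∈ t_{π,w}} (X^{f(w|v)} - b)`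
of Arthur–Clozel 1989, Ch. 3, Def. 6.1, (6.1)–(6.2); Henniart 2012, (1.1)), then so is
`P ⊗ |det|_{𝔸_K}^s` from `π ⊗ |det|_{𝔸_L}^s`, for every `s ∈ ℂ` and the Borel–Jacquet twists of
`AutomorphicTwistNorm` (`t_{π ⊗ |det|^s, w} = q_w^{-s} t_{π,w}`): since `q_w = q_v^{f(w|v)}`,
`∏_a (X - q_v^{-s} a) = ∏_{w ∣ v} ∏_b (X^{f} - q_w^{-s} b)` follows from the untwisted identity by
the substitution `X ↦ q_v^{s} X`. This is the "on se ramène au cas unitaire" step of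
Arthur–Clozel (Ch. 3, proof of Thm. 3.1: "We may assume `π, π'` unitary") / Henniart 2012, §1.18,
for automorphic induction, at the level of Satake parameters (the archimedean side is
`ArchParameterTwistNorm`).

* `satakePolynomial_cons`, `satakePolynomial_map_mul` — `∏_a (X - c a) = c^{#α} P_α(c⁻¹ X)`;
  `comp_X_pow_comp_C_mul_X`, `satakePolynomial_map_mul_comp_X_pow_comp` — one factor of the
  induced polynomial under `X ↦ c⁻¹ X` when `c^f d = 1`.
* `satakePolynomial_map_mul_eq_inducedSatakePolynomial` — the algebraic heart: from
  `P_α = ∏_{w ∣ v} P_{d_w β'_w}(X^{f_w})` and `c^{f_w} d_w = 1` (`w ∣ v`), `P_{cα} = ∏_{w ∣ v} P_{β'_w}(X^{f_w})`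
  (compare `C u ·` both sides, both monic).
* `residueCard_cpow_neg_pow_mul_residueCard_cpow` — `(q_v^{-s})^{f(w|v)} q_w^{s} = 1`
  (`residueCard_eq_pow_inertiaDeg`).
* `IsAutomorphicInductionAlong.of_normTwist` — **the compatibility**, for data `π' = π ⊗ |det|_L^s`,
  `P' = P ⊗ |det|_K^s` given by `π'.W = |det|^s · π.W` etc.

## References

* J. Arthur, L. Clozel, Ann. of Math. Stud. 120 (1989), Ch. 3, Def. 6.1, (6.1)–(6.2); proof of
  Thm. 3.1 (unitary normalisation). [ArthurClozelAMS120]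
* G. Henniart, Bull. SMF 140 (2012), §1.10 (1.1), §1.18. [Henniart2012]
* A. Borel, H. Jacquet, Corvallis 1979, 5.7. [BorelJacquet1979]
-/

noncomputable section

open scoped Classical Polynomial
open NumberField IsDedekindDomain Filter Polynomial Literature.NumberTheory.Automorphic

namespace Literature.NumberTheory.Automorphic

open Literature.NumberTheory.GaloisRepresentations (HeckeCharacter ideleGroup)

/-! ### Scaling Satake polynomials -/

section Algebra

/-- `P_{a ∷ α} = (X - a) P_α`. [folklore] -/
theorem satakePolynomial_cons (a : ℂ) (α : Multiset ℂ) :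
    satakePolynomial (a ::ₘ α) = (X - C a) * satakePolynomial α := by
  rw [satakePolynomial, satakePolynomial, Multiset.map_cons, Multiset.prod_cons]

/-- **Scaling the roots**: `∏_{a ∈ α} (X - c a) = c^{#α} · P_α(c⁻¹ X)` for `c ≠ 0`. [folklore] -/
theorem satakePolynomial_map_mul {c : ℂ} (hc : c ≠ 0) (α : Multiset ℂ) :
    satakePolynomial (α.map (c * ·)) =
      C (c ^ Multiset.card α) * (satakePolynomial α).comp (C c⁻¹ * X) := by
  induction α using Multiset.induction_on with
  | empty => simp [satakePolynomial]
  | cons a α ih =>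
    rw [Multiset.map_cons, satakePolynomial_cons, satakePolynomial_cons, ih, Multiset.card_cons,
      pow_succ, mul_comp, sub_comp, X_comp, C_comp]
    have e : X - C (c * a) = C c * (C c⁻¹ * X - C a) := by
      rw [mul_sub, ← mul_assoc, ← C_mul, mul_inv_cancel₀ hc, C_1, one_mul, ← C_mul]
    rw [e, map_mul]
    ring

/-- `(p(X^f))(u X) = p(u^f X^f)`. [folklore] -/
theorem comp_X_pow_comp_C_mul_X (p : ℂ[X]) (f : ℕ) (u : ℂ) :
    (p.comp (X ^ f)).comp (C u * X) = p.comp (C (u ^ f) * X ^ f) := by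
  rw [comp_assoc, X_pow_comp, mul_pow, ← C_pow]

/-- **One factor of the induced polynomial under `X ↦ c⁻¹ X`**: if `c^f d = 1` then
`P_{d β}(X^f)` composed with `c⁻¹ X` is `d^{#β} · P_β(X^f)`. [folklore] -/
theorem satakePolynomial_map_mul_comp_X_pow_comp {c d : ℂ} {f : ℕ} (hcd : c ^ f * d = 1)
    (β : Multiset ℂ) :
    ((satakePolynomial (β.map (d * ·))).comp (X ^ f)).comp (C c⁻¹ * X) =
      C (d ^ Multiset.card β) * (satakePolynomial β).comp (X ^ f) := by
  have hd : d ≠ 0 := by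
    rintro rfl
    rw [mul_zero] at hcd
    exact zero_ne_one hcd
  have hdinv : d⁻¹ * c⁻¹ ^ f = 1 := by
    rw [inv_pow, ← mul_inv, inv_eq_one, mul_comm, hcd]
  rw [comp_X_pow_comp_C_mul_X, satakePolynomial_map_mul hd, C_mul_comp, comp_assoc, mul_comp,
    C_comp, X_comp, ← mul_assoc, ← C_mul, hdinv, C_1, one_mul]

variable {K : Type} [Field K] [NumberField K] {L : Type} [Field L] [NumberField L] [Algebra K L]

/-- **The algebraic heart of the twist-compatibility of automorphic induction.** Let `c ≠ 0` and,
for the places `w ∣ v`, numbers `d_w` with `c^{f(w|v)} d_w = 1`. If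
`P_α = ∏_{w ∣ v} P_{d_w β'_w}(X^{f(w|v)})` then `P_{c α} = ∏_{w ∣ v} P_{β'_w}(X^{f(w|v)})`:
substitute `X ↦ c⁻¹ X` (`satakePolynomial_map_mul`, `satakePolynomial_map_mul_comp_X_pow_comp`)
to get `P_{cα} = C u · ∏_{w ∣ v} P_{β'_w}(X^{f})` for a unit `u`, and compare leading coefficients
(both sides are monic). For `c = q_v^{-s}`, `d_w = q_w^{s}` this is the passage from the
Satake relation (6.1)–(6.2) for `(P, π)` to the one for `(P ⊗ |det|^s, π ⊗ |det|^s)`.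
[cite: ArthurClozelAMS120, Ch. 3 Def. 6.1 and (6.1)–(6.2)] -/
theorem satakePolynomial_map_mul_eq_inducedSatakePolynomial (v : HeightOneSpectrum (𝓞 K))
    {α : Multiset ℂ} {β β' : HeightOneSpectrum (𝓞 L) → Multiset ℂ} {c : ℂ} (hc : c ≠ 0)
    (d : HeightOneSpectrum (𝓞 L) → ℂ)
    (hd : ∀ w : HeightOneSpectrum (𝓞 L), w.asIdeal.under (𝓞 K) = v.asIdeal →
      c ^ w.asIdeal.inertiaDeg (𝓞 K) * d w = 1)
    (hβ : ∀ w : HeightOneSpectrum (𝓞 L), w.asIdeal.under (𝓞 K) = v.asIdeal →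
      β w = (β' w).map (d w * ·))
    (h : satakePolynomial α = inducedSatakePolynomial v β) :
    satakePolynomial (α.map (c * ·)) = inducedSatakePolynomial v β' := by
  have hS := finite_setOf_asIdeal_under_eq (E := L) v
  -- the unit relating the two sides
  set u : ℂ := c ^ Multiset.card α *
    ∏ w ∈ hS.toFinset, d w ^ Multiset.card (β' w) with hu
  have key : satakePolynomial (α.map (c * ·)) = C u * inducedSatakePolynomial v β' := by
    rw [satakePolynomial_map_mul hc, h, inducedSatakePolynomial, inducedSatakePolynomial,
      finprod_mem_eq_finite_toFinset_prod _ hS, finprod_mem_eq_finite_toFinset_prod _ hS, prod_comp,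
      Finset.prod_congr rfl fun w hw => by
        rw [hβ w (hS.mem_toFinset.mp hw),
          satakePolynomial_map_mul_comp_X_pow_comp (hd w (hS.mem_toFinset.mp hw))],
      Finset.prod_mul_distrib, ← map_prod C, ← mul_assoc, ← C_mul, hu]
  -- both sides are monic, so `u = 1`
  have hmonicR : (inducedSatakePolynomial v β').Monic := by
    rw [inducedSatakePolynomial, finprod_mem_eq_finite_toFinset_prod _ hS]
    refine monic_prod_of_monic _ _ fun w _ => (monic_satakePolynomial _).comp (monic_X_pow _) ?_
    rw [natDegree_X_pow]
    haveI := w.isPrime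
    exact (Ideal.inertiaDeg_pos w.asIdeal (𝓞 K)).ne'
  have hu1 : u = 1 := by
    have e := congrArg leadingCoeff key
    rwa [(monic_satakePolynomial _).leadingCoeff, hmonicR.leadingCoeff_C_mul, eq_comm] at e
  rw [key, hu1, C_1, one_mul]

/-- `((q ^ k : ℕ) : ℂ) ^ s = ((q : ℂ) ^ s) ^ k` (a copy of `natCast_pow_cpow` of
`JacquetShalikaEulerProducts`, not imported here). [folklore] -/
private theorem natCast_pow_cpow' (q k : ℕ) (s : ℂ) : ((q ^ k : ℕ) : ℂ) ^ s = ((q : ℂ) ^ s) ^ k := by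
  induction k with
  | zero => simp
  | succ k ih => rw [pow_succ, Nat.cast_mul, Complex.natCast_mul_natCast_cpow, ih, pow_succ]

/-- **`(q_v^{-s})^{f(w|v)} · q_w^{s} = 1`** for `w ∣ v` (`q_w = q_v^{f(w|v)}`,
`residueCard_eq_pow_inertiaDeg`). [folklore] -/
theorem residueCard_cpow_neg_pow_mul_residueCard_cpow {v : HeightOneSpectrum (𝓞 K)}
    {w : HeightOneSpectrum (𝓞 L)} (hw : w.asIdeal.under (𝓞 K) = v.asIdeal) (s : ℂ) :
    ((v.residueCard : ℂ) ^ (-s)) ^ w.asIdeal.inertiaDeg (𝓞 K) * (w.residueCard : ℂ) ^ s = 1 := by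
  have hv : w.under (𝓞 K) = v := HeightOneSpectrum.ext (by rw [HeightOneSpectrum.under_asIdeal, hw])
  have hq : (v.residueCard : ℂ) ≠ 0 := by
    have := v.one_lt_residueCard
    exact_mod_cast (by omega : v.residueCard ≠ 0)
  have hqs : (v.residueCard : ℂ) ^ s ≠ 0 := fun h0 => hq ((Complex.cpow_eq_zero_iff _ _).1 h0).1
  rw [residueCard_eq_pow_inertiaDeg (F := K) w, hv, natCast_pow_cpow', ← mul_pow, Complex.cpow_neg,
    inv_mul_cancel₀ hqs, one_pow]

end Algebra

/-! ### Automorphic induction commutes with `⊗ |det|^s` -/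

section Twist

variable {K : Type} [Field K] [NumberField K] {L : Type} [Field L] [NumberField L] [Algebra K L]
  {N n : ℕ} {hK : isCompact_glFiniteIntegralLevel N K} {hL : isCompact_glFiniteIntegralLevel n L}

/-- **Automorphic induction is compatible with the twists `⊗ |det|_𝔸^s`** (Arthur–Clozel 1989,
Ch. 3, Def. 6.1; the normalisation step "We may assume `π, π'` unitary" of the proof of Thm. 3.1,
and Henniart 2012, §1.18, for automorphic induction). Let `s ∈ ℂ`, `χ_K = ‖·‖_{𝔸_K}^s`,
`χ_L = ‖·‖_{𝔸_L}^s`, and let `π' = π ⊗ (χ_L ∘ det)`, `P' = P ⊗ (χ_K ∘ det)` be the Borel–Jacquet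
twists (`AutomorphicTwistNorm`: `π'.W = |det|^s · π.W`, …). If `P` is automorphically induced
from `π` along `L/K` (a.e. relation (6.1)–(6.2)), then `P'` is automorphically induced from `π'`:
`t_{π',w} = q_w^{-s} t_{π,w}`, `t_{P',v} = q_v^{-s} t_{P,v}` and `q_w = q_v^{f(w|v)}`.
[cite: ArthurClozelAMS120, Ch. 3 Def. 6.1 and (6.1)–(6.2)] [cite: Henniart2012, §1.18] -/
theorem IsAutomorphicInductionAlong.of_normTwist {s : ℂ} {χK : HeckeCharacter K}
    {χL : HeckeCharacter L}
    (hχK : ∀ x : ideleGroup K, ((χK x : ℂˣ) : ℂ) = (GaloisRepresentations.ideleNorm x : ℂ) ^ s)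
    (hχL : ∀ y : ideleGroup L, ((χL y : ℂˣ) : ℂ) = (GaloisRepresentations.ideleNorm y : ℂ) ^ s)
    {π π' : AutomorphicRepData (AutomorphyDatum.gl n L hL)}
    (hπW : π'.W = π.W.map (mulChar (detTwist n χL)))
    (hπW' : π'.W' = π.W'.map (mulChar (detTwist n χL)))
    {P P' : AutomorphicRepData (AutomorphyDatum.gl N K hK)}
    (hPW : P'.W = P.W.map (mulChar (detTwist N χK)))
    (hPW' : P'.W' = P.W'.map (mulChar (detTwist N χK)))
    (h : IsAutomorphicInductionAlong π P) : IsAutomorphicInductionAlong π' P' := by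
  -- `π = π' ⊗ |det|^{-s}`
  have hinvW : π.W = π'.W.map (mulChar (detTwist n χL⁻¹)) := by
    rw [detTwist_inv, hπW, map_mulChar_inv_map_mulChar]
  have hinvW' : π.W' = π'.W'.map (mulChar (detTwist n χL⁻¹)) := by
    rw [detTwist_inv, hπW', map_mulChar_inv_map_mulChar]
  have hχL' := inv_apply_of_cpow hχL
  have hq : (∀ v : HeightOneSpectrum (𝓞 K), ((v.residueCard : ℂ) ^ (-s)) ≠ 0) := fun v h0 => by
    have h1 := v.one_lt_residueCard
    have : (v.residueCard : ℂ) ≠ 0 := by exact_mod_cast (by omega : v.residueCard ≠ 0)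
    exact this ((Complex.cpow_eq_zero_iff _ _).1 h0).1
  filter_upwards [h] with v hv β' hβ'
  -- Satake parameters of `π` above `v`, from those of `π'`
  have hβ : ∀ w : HeightOneSpectrum (𝓞 L), w.asIdeal.under (𝓞 K) = v.asIdeal →
      π.HasSatakeParamAt w ((β' w).map ((((w.residueCard : ℂ) ^ (-(-s))) * ·))) := fun w hw =>
    AutomorphicRepData.HasSatakeParamAt.of_map_mulChar_detTwist_of_cpow hχL' hinvW hinvW' (hβ' w hw)
  obtain ⟨α, hα, hrel⟩ := hv _ hβ
  refine ⟨α.map (((v.residueCard : ℂ) ^ (-s)) * ·),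
    AutomorphicRepData.HasSatakeParamAt.of_map_mulChar_detTwist_of_cpow hχK hPW hPW' hα, ?_⟩
  refine satakePolynomial_map_mul_eq_inducedSatakePolynomial v (hq v)
    (fun w => (w.residueCard : ℂ) ^ (-(-s))) (fun w hw => ?_) (fun w _ => rfl) hrel
  rw [neg_neg]
  exact residueCard_cpow_neg_pow_mul_residueCard_cpow hw s

end Twist

end Literature.NumberTheory.Automorphic
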